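import Literature.Computability.Complexity.CircuitReduce
import Literature.Combinatorics.SimpleGraph.HamiltonianCycleListings

/-!
# The Held–Karp dynamic programme as an exact, rigid, symmetric threshold circuit for
# Hamiltonicity, with small orbits under a point stabiliser

Everything PROVED; no named facts. For every `m ≥ 3` and every "budget" `g` we construct
(`HeldKarp.exists_symmetric_circuit`) a straight-line `tcBasis`-circuit on `m × m` Boolean matrices
(`Circuit (Fin m × Fin m)`, tree file `Circuit.lean`) which

* computes `x ↦ [Gr x is Hamiltonian]` EXACTLY, `Gr x = SimpleGraph.fromRel (x · · = true)` (the
  symmetrised, loop-free decoding used throughout the tree);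
* is symmetric (`Circuit.IsSymmetricUnder`, Anderson–Dawar 2017 §2) under the point stabiliser
  `pointStabiliserBudget m g` (permutations of `Fin m` fixing every `i` with `i + g < m`) — indeed
  under ALL of `Sym(Fin m)` (`HeldKarp.compile_hkDAG_isSymmetricUnder`) — and RIGID;
* and whose every gate orbit under `pointStabiliserBudget m g` (`Circuit.orbitSize`, the `ORB` of
  Dawar–Wilsenach 2025 §3.2) has at most `max (2^g·(g+1)^3) m²` elements.

The circuit is the Held–Karp dynamic programme (Held–Karp 1962): gates `P(U,a,b)` = "some path of
`Gr x` runs from `a` to `b` and has vertex set exactly `U`" (`U ⊆ Fin m`), realised as the DAG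
`P(U,a,b) = ⋁_c [P(U∖b,a,c) ∧ E(c,b)]` on the gate type `HKNode m` (`HeldKarp.hkDAG`), compiled by
`GateDAG.compile` (`CircuitDAG.lean`) and rigidified by `GateDAG.reduce` (Anderson–Dawar Lemma 7,
`CircuitReduce.lean`). Semantics: `HeldKarp.val_P_iff` (the DAG evaluates the Held–Karp table, by
induction on `|U|` through the list recursion `HeldKarp.hkSpec_step`) and
`HeldKarp.isHamiltonian_iff_hkSpec` (via `isHamiltonian_iff_of_three_le_card` of
`HamiltonianCycleListings.lean`). Symmetry: a vertex permutation `ρ` acts on gate indices by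
`(U,a,b) ↦ (ρU, ρa, ρb)` (`HeldKarp.hkDAG_isAut`). Orbits: for `ρ` in the point stabiliser only the
`≤ g` free vertices move, so a traced orbit has `≤ 2^g (g+1)^3` gates (`HeldKarp.ncard_traced_le`),
and `GateDAG.ncard_orbit_reduce_le` transfers the bound to the rigid reduced circuit.

Why it is here (consumers). (1) Route PneNP/SymmetryBudget, crux `WindowHam` (stmt-PneNP-2143): at
the window budget `g = ⌊log₂ m⌋` the bound is `m·(⌊log₂ m⌋+1)³ ⊔ m²` — POLYNOMIAL orbits for an
EXACT Hamiltonicity circuit — so no argument whose only handle on a window-symmetric circuit is a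
polynomial orbit bound can prove a size lower bound there (tightness lemma "BN-W2" of the crux
notes). (2) At full symmetry the orbits are `2^m·(m+1)^3 = 2^{m + O(log m)}`: the hypothesis
`ORB(C_n) = 2^{o(n)}` of Dawar–Wilsenach 2025 Thm 6.4 (`DawarWilsenach2025_orbitSize_countingWidth`,
which for Hamiltonicity — counting width `Ω(n)` — forbids such circuits) cannot be relaxed to
`2^{O(n)}`. (3) `HeldKarp.hasSymCircuit_ham`: the symmetric circuit complexity of Hamiltonicity of
`m`-vertex graphs is at most `7·2^m·m³` under every permutation set (the DNF gives `2^{m²}`).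

Not here: the uniform / FPC reading, Held–Karp for TSP with weights, lower bounds.

## References

* M. Held, R. M. Karp, *A dynamic programming approach to sequencing problems*, J. SIAM 10 (1962)
  196–210 (the recursion `hkSpec_step`).
* M. Anderson, A. Dawar, *On symmetric circuits and fixed-point logics*, Theory Comput. Syst. 60
  (2017), §2 (symmetric circuits, automorphisms), Lemma 7 (rigidification).
* A. Dawar, G. Wilsenach, *Symmetric arithmetic circuits*, Theory of Computing 21 (2025), §3.2
  (orbits), Thm 6.4.
-/

namespace Literature.Computability.Complexity.HeldKarp

open Finset

/-! ## §1 Paths with a prescribed vertex set (the Held–Karp states), as lists -/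

section Spec

variable {V : Type*} [DecidableEq V] {R : V → V → Prop}

/-- `HKSpec R U a b`: some duplicate-free `R`-chain starts at `a`, ends at `b` and has vertex set
exactly `U` — the meaning of the Held–Karp table entry `(U,a,b)`. [folklore] -/
def HKSpec (R : V → V → Prop) (U : Finset V) (a b : V) : Prop :=
  ∃ l : List V, l.Nodup ∧ l.toFinset = U ∧ List.IsChain R l ∧ l.head? = some a ∧ l.getLast? = some b

/-- The start vertex belongs to the vertex set. [folklore] -/
theorem HKSpec.left_mem {U : Finset V} {a b : V} (h : HKSpec R U a b) : a ∈ U := by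
  obtain ⟨l, -, rfl, -, ha, -⟩ := h
  exact List.mem_toFinset.2 (List.mem_of_mem_head? ha)

/-- The end vertex belongs to the vertex set. [folklore] -/
theorem HKSpec.right_mem {U : Finset V} {a b : V} (h : HKSpec R U a b) : b ∈ U := by
  obtain ⟨l, -, rfl, -, -, hb⟩ := h
  exact List.mem_toFinset.2 (List.mem_of_mem_getLast? hb)

/-- Base of the Held–Karp recursion: the one-vertex path. [folklore] -/
theorem hkSpec_singleton_iff (a c : V) : HKSpec R {a} a c ↔ c = a := by
  constructor
  · rintro ⟨l, hnd, hU, -, ha, hc⟩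
    have hlen : l.length = 1 := by
      rw [← List.toFinset_card_of_nodup hnd, hU, Finset.card_singleton]
    match l, hlen, ha, hc with
    | [v], _, ha, hc =>
      simp only [List.head?_cons, Option.some.injEq] at ha
      simp only [List.getLast?_singleton, Option.some.injEq] at hc
      rw [← hc, ha]
  · rintro rfl
    exact ⟨[c], List.nodup_singleton c, by simp, List.isChain_singleton c, rfl, rfl⟩

/-- A duplicate-free chain on at least two vertices does not return to its start. [folklore] -/
theorem not_hkSpec_self {U : Finset V} {a : V} (hU : 2 ≤ U.card) : ¬ HKSpec R U a a := by
  rintro ⟨l, hnd, hUl, -, ha, hb⟩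
  have hlen : 2 ≤ l.length := by rwa [← List.toFinset_card_of_nodup hnd, hUl]
  match l, hlen, hnd, ha, hb with
  | x :: y :: t, _, hnd, ha, hb =>
    simp only [List.head?_cons, Option.some.injEq] at ha
    subst ha
    rw [List.getLast?_eq_some_getLast (List.cons_ne_nil _ _), Option.some.injEq,
      List.getLast_cons (List.cons_ne_nil y t)] at hb
    have hmem : x ∈ y :: t := hb ▸ List.getLast_mem _
    exact (List.nodup_cons.1 hnd).1 hmem

/-- **The Held–Karp recursion** (Held–Karp 1962): for `a ≠ b`, a duplicate-free chain from `a` to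
`b` with vertex set `U` is one from `a` to some `c ∈ U ∖ b` with vertex set `U ∖ b`, followed by the
step `c → b`. [folklore] -/
theorem hkSpec_step {U : Finset V} {a b : V} (hab : a ≠ b) :
    HKSpec R U a b ↔ b ∈ U ∧ ∃ c ∈ U.erase b, R c b ∧ HKSpec R (U.erase b) a c := by
  constructor
  · rintro ⟨l, hnd, hUl, hch, ha, hb⟩
    obtain ⟨l', b', rfl⟩ : ∃ l' b', l = l' ++ [b'] := by
      rcases List.eq_nil_or_concat l with rfl | ⟨l', b', rfl⟩
      · simp at ha
      · exact ⟨l', b', List.concat_eq_append⟩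
    have hb' : b' = b := by simpa using hb
    subst hb'
    have hbl' : b' ∉ l' := fun h => by
      rw [List.nodup_append_comm] at hnd
      exact (List.nodup_cons.1 hnd).1 h
    have hnd' : l'.Nodup := hnd.sublist (List.sublist_append_left l' [b'])
    have hne' : l' ≠ [] := by
      rintro rfl
      have : b' = a := by simpa using ha
      exact hab this.symm
    have hU' : l'.toFinset = U.erase b' := by
      rw [← hUl, List.toFinset_append]
      ext v
      simp only [Finset.mem_erase, Finset.mem_union, List.mem_toFinset, List.mem_singleton]
      constructor
      · intro hv
        exact ⟨fun h => hbl' (h ▸ hv), Or.inl hv⟩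
      · rintro ⟨hvb, hv | hv⟩
        · exact hv
        · exact absurd hv hvb
    have hbU : b' ∈ U := by
      rw [← hUl]
      simp
    rw [List.isChain_append] at hch
    obtain ⟨hch', -, hlink⟩ := hch
    refine ⟨hbU, l'.getLast hne', ?_, ?_, l', hnd', hU', hch', ?_, List.getLast?_eq_some_getLast hne'⟩
    · rw [← hU', List.mem_toFinset]
      exact List.getLast_mem hne'
    · exact hlink _ (List.getLast?_eq_some_getLast hne') b' rfl
    · rw [List.head?_append, List.head?_eq_some_head hne'] at ha
      rw [List.head?_eq_some_head hne']
      simpa using ha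
  · rintro ⟨hbU, c, hc, hR, l', hnd', hUl', hch', ha', hc'⟩
    have hbl' : b ∉ l' := fun h => by
      have : b ∈ l'.toFinset := List.mem_toFinset.2 h
      rw [hUl'] at this
      exact Finset.notMem_erase b U this
    refine ⟨l' ++ [b], ?_, ?_, ?_, ?_, ?_⟩
    · rw [List.nodup_append_comm]
      exact List.nodup_cons.2 ⟨hbl', hnd'⟩
    · rw [List.toFinset_append, hUl']
      ext v
      simp only [Finset.mem_union, Finset.mem_erase, List.mem_toFinset, List.mem_singleton]
      constructor
      · rintro (⟨-, hv⟩ | rfl)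
        · exact hv
        · exact hbU
      · intro hv
        by_cases hvb : v = b
        · exact Or.inr hvb
        · exact Or.inl ⟨hvb, hv⟩
    · rw [List.isChain_append]
      refine ⟨hch', List.isChain_singleton b, fun x hx y hy => ?_⟩
      rw [hc'] at hx
      simp only [Option.mem_def, Option.some.injEq] at hx
      simp only [List.head?_cons, Option.mem_def, Option.some.injEq] at hy
      subst hx; subst hy
      exact hR
    · rw [List.head?_append, ha']
      rfl
    · rw [List.getLast?_append]
      rfl

end Spec

/-- **Hamiltonicity through the Held–Karp table**: on at least three vertices a graph is
Hamiltonian iff some duplicate-free path `a ⋯ b` through ALL vertices closes up by an edge `b a`. [folklore] -/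
theorem isHamiltonian_iff_hkSpec {V : Type*} [Fintype V] [DecidableEq V] (G : SimpleGraph V)
    (h3 : 3 ≤ Fintype.card V) :
    G.IsHamiltonian ↔ ∃ a b, a ≠ b ∧ G.Adj b a ∧ HKSpec G.Adj Finset.univ a b := by
  rw [Literature.Combinatorics.SimpleGraph.isHamiltonian_iff_of_three_le_card G h3]
  constructor
  · rintro ⟨l, hl⟩
    rw [Literature.Combinatorics.SimpleGraph.isHamCycleListing_iff_isChain] at hl
    obtain ⟨hnd, hall, hch, hlast⟩ := hl
    have hne : l ≠ [] := by
      have : Nonempty V := Fintype.card_pos_iff.1 (by omega)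
      obtain ⟨v⟩ := this
      exact List.ne_nil_of_mem (hall v)
    have hU : l.toFinset = Finset.univ :=
      Finset.eq_univ_iff_forall.2 fun v => List.mem_toFinset.2 (hall v)
    have hlen : l.length = Fintype.card V := by
      rw [← List.toFinset_card_of_nodup hnd, hU, Finset.card_univ]
    refine ⟨l.head hne, l.getLast hne, ?_, hlast hne, l, hnd, hU, hch, List.head?_eq_some_head hne,
      List.getLast?_eq_some_getLast hne⟩
    intro heq
    rw [List.head_eq_getElem, List.getLast_eq_getElem] at heq
    have := (List.Nodup.getElem_inj_iff hnd).1 heq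
    omega
  · rintro ⟨a, b, -, hadj, l, hnd, hU, hch, ha, hb⟩
    refine ⟨l, (Literature.Combinatorics.SimpleGraph.isHamCycleListing_iff_isChain _ _).2
      ⟨hnd, fun v => ?_, hch, fun hne => ?_⟩⟩
    · have : v ∈ l.toFinset := hU ▸ Finset.mem_univ v
      exact List.mem_toFinset.1 this
    · rw [List.head?_eq_some_head hne, Option.some.injEq] at ha
      rw [List.getLast?_eq_some_getLast hne, Option.some.injEq] at hb
      rw [ha, hb]
      exact hadj

/-! ## §2 The Held–Karp DAG -/

/-- Gate indices of the Held–Karp circuit on `m` vertices: table entries `tab U a b` (the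
`P(U,a,b)` of the module docstring), their branches `br U a b c = P(U∖b,a,c) ∧ E(c,b)`, symmetrised
adjacency `edge c b = E(c,b) = x(c,b) ∨ x(b,c)`, the closing tests `cl a b = P(univ,a,b) ∧ E(b,a)`,
their disjunctions `st a = ⋁_b cl a b`, the output `⋁_a st a`, and a constant `false`. [folklore] -/
inductive HKNode (m : ℕ)
  | tab (U : Finset (Fin m)) (a b : Fin m)
  | br (U : Finset (Fin m)) (a b c : Fin m)
  | edge (c b : Fin m)
  | cl (a b : Fin m)
  | st (a : Fin m)
  | out
  | ff
  deriving DecidableEq, Fintype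

namespace HKNode

variable {m : ℕ}

/-- Gate functions: unbounded fan-in `∨`, binary `∧`/`∨`, and `∨₀ = false`. [folklore] -/
def fn : HKNode m → GateFn
  | tab _ _ _ => GateFn.or m
  | br _ _ _ _ => GateFn.and 2
  | edge _ _ => GateFn.or 2
  | cl _ _ => GateFn.and 2
  | st _ => GateFn.or m
  | out => GateFn.or m
  | ff => GateFn.or 0

/-- Argument wires. [folklore] -/
def args : (l : HKNode m) → Fin (fn l).1 → (Fin m × Fin m) ⊕ HKNode m
  | tab U a b => fun c => if (a ∈ U ∧ b ∈ U ∧ a ≠ b ∧ c ∈ U.erase b) then Sum.inr (br U a b c) else Sum.inr ff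
  | br U a b c => fun i => if (i : ℕ) = 0 then
        (if U.erase b = {a} then Sum.inr (edge c b) else Sum.inr (tab (U.erase b) a c))
      else Sum.inr (edge c b)
  | edge c b => fun i => if (i : ℕ) = 0 then Sum.inl (c, b) else Sum.inl (b, c)
  | cl a b => fun i => if a = b then Sum.inr ff else
      (if (i : ℕ) = 0 then Sum.inr (tab Finset.univ a b) else Sum.inr (edge b a))
  | st a => fun b => Sum.inr (cl a b)
  | out => fun a => Sum.inr (st a)
  | ff => fun i => i.elim0

/-- The argument list of a branch gate. [folklore] -/
theorem ofFn_args_A (U : Finset (Fin m)) (a b c : Fin m) :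
    List.ofFn (args (br U a b c)) =
      [if U.erase b = {a} then Sum.inr (edge c b) else Sum.inr (tab (U.erase b) a c), Sum.inr (edge c b)] :=
  rfl

/-- The argument list of a symmetrised-adjacency gate. [folklore] -/
theorem ofFn_args_E (c b : Fin m) :
    List.ofFn (args (edge c b)) = [Sum.inl (c, b), Sum.inl (b, c)] := rfl

/-- The argument list of a closing-test gate. [folklore] -/
theorem ofFn_args_R (a b : Fin m) :
    List.ofFn (args (cl a b)) =
      [if a = b then Sum.inr ff else Sum.inr (tab Finset.univ a b),
        if a = b then Sum.inr ff else Sum.inr (edge b a)] := by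
  by_cases h : a = b <;> simp [args, h] <;> rfl

/-- The constant gate has no arguments. [folklore] -/
theorem ofFn_args_ff : List.ofFn (args (ff : HKNode m)) = [] := rfl

/-- A rank function decreasing along the wires. [folklore] -/
def rank : HKNode m → ℕ
  | tab U _ _ => 2 * U.card + 2
  | br U _ b _ => 2 * (U.erase b).card + 3
  | edge _ _ => 0
  | cl _ _ => 2 * m + 5
  | st _ => 2 * m + 6
  | out => 2 * m + 7
  | ff => 0

/-- Gate wires point to gates of smaller rank (acyclicity). [folklore] -/
theorem rank_lt_of_args {l l' : HKNode m} {i : Fin (fn l).1} (h : args l i = Sum.inr l') :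
    rank l' < rank l := by
  cases l with
  | tab U a b =>
    simp only [args] at h
    split_ifs at h with hv
    · cases h
      simp only [rank]
      have hb : b ∈ U := hv.2.1
      have := Finset.card_erase_of_mem hb
      have hpos : 0 < U.card := Finset.card_pos.2 ⟨b, hb⟩
      omega
    · cases h
      simp [rank]
  | br U a b c =>
    simp only [args] at h
    split_ifs at h with h0 h1 <;> cases h <;> simp [rank]
  | edge c b =>
    simp only [args] at h
    split_ifs at h
  | cl a b =>
    simp only [args] at h
    split_ifs at h with h0 h1 <;> cases h <;> simp [rank, Finset.card_univ]
  | st a => cases h; simp [rank]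
  | out => cases h; simp [rank]
  | ff => exact i.elim0

/-- The action of a vertex permutation on gate indices. [folklore] -/
def act (ρ : Equiv.Perm (Fin m)) : HKNode m → HKNode m
  | tab U a b => tab (U.image ρ) (ρ a) (ρ b)
  | br U a b c => br (U.image ρ) (ρ a) (ρ b) (ρ c)
  | edge c b => edge (ρ c) (ρ b)
  | cl a b => cl (ρ a) (ρ b)
  | st a => st (ρ a)
  | out => out
  | ff => ff

/-- `ρ⁻¹ (ρ U) = U`. [folklore] -/
theorem image_image_symm (ρ : Equiv.Perm (Fin m)) (U : Finset (Fin m)) :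
    (U.image ρ).image ρ.symm = U := by
  rw [Finset.image_image, Equiv.symm_comp_self, Finset.image_id]

/-- `act ρ⁻¹` inverts `act ρ`. [folklore] -/
theorem act_symm_act (ρ : Equiv.Perm (Fin m)) (l : HKNode m) : act ρ.symm (act ρ l) = l := by
  cases l <;> simp [act, image_image_symm]

/-- The action as a permutation of the gate indices. [folklore] -/
def actEquiv (ρ : Equiv.Perm (Fin m)) : HKNode m ≃ HKNode m where
  toFun := act ρ
  invFun := act ρ.symm
  left_inv := act_symm_act ρ
  right_inv l := by simpa using act_symm_act ρ.symm l

/-- `actEquiv` is `act`. [folklore] -/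
@[simp] theorem actEquiv_apply (ρ : Equiv.Perm (Fin m)) (l : HKNode m) : actEquiv ρ l = act ρ l :=
  rfl

end HKNode

open HKNode

variable {m : ℕ}

/-- **The Held–Karp circuit as a DAG** on the gate type `HKNode m`. [folklore] -/
noncomputable def hkDAG (m : ℕ) : GateDAG (Fin m × Fin m) (HKNode m) where
  fn := HKNode.fn
  args := HKNode.args
  out := Sum.inr HKNode.out
  wf := Subrelation.wf (fun ⟨_, h⟩ => rank_lt_of_args h) (InvImage.wf rank Nat.lt_wfRel.wf)

/-- The gate functions of the DAG. [folklore] -/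
theorem hkDAG_fn (l : HKNode m) : (hkDAG m).fn l = HKNode.fn l := rfl

/-- All gate functions lie in `acBasis ⊆ tcBasis`. [folklore] -/
theorem hkDAG_fn_mem_acBasis (l : HKNode m) : (hkDAG m).fn l ∈ acBasis := by
  cases l <;>
    first
    | exact Or.inr (Set.mem_iUnion.2 ⟨_, Or.inr rfl⟩)
    | exact Or.inr (Set.mem_iUnion.2 ⟨_, Or.inl rfl⟩)

/-- All gate functions lie in the threshold basis. [folklore] -/
theorem hkDAG_fn_mem_tcBasis (l : HKNode m) : (hkDAG m).fn l ∈ tcBasis :=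
  acBasis_subset_tcBasis (hkDAG_fn_mem_acBasis l)

/-- All gate functions are symmetric Boolean functions. [folklore] -/
theorem hkDAG_fn_isSymmetric (l : HKNode m) : ((hkDAG m).fn l).IsSymmetric :=
  isSymmetric_of_mem_tcBasis (hkDAG_fn_mem_tcBasis l)

/-! ## §3 Semantics: the DAG evaluates the Held–Karp table -/

section Semantics

variable (x : Fin m × Fin m → Bool)

/-- The graph decoded from the matrix `x` (route convention). [folklore] -/
abbrev Gr (x : Fin m × Fin m → Bool) : SimpleGraph (Fin m) :=
  SimpleGraph.fromRel fun u v => x (u, v) = true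

/-- The constant gate is `false`. [folklore] -/
theorem val_ff : (hkDAG m).val x HKNode.ff = false := by
  rw [GateDAG.val_eq]
  show decide (∃ i : Fin 0, GateDAG.wire x ((hkDAG m).val x) i.elim0 = true) = false
  simp

/-- The gate `E c b` computes the symmetrised entry `x(c,b) ∨ x(b,c)`. [folklore] -/
theorem val_E (c b : Fin m) :
    (hkDAG m).val x (edge c b) = true ↔ (x (c, b) = true ∨ x (b, c) = true) := by
  rw [GateDAG.val_eq]
  show decide (∃ i : Fin 2, GateDAG.wire x ((hkDAG m).val x)
    (if (i : ℕ) = 0 then Sum.inl (c, b) else Sum.inl (b, c)) = true) = true ↔ _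
  rw [decide_eq_true_iff, Fin.exists_fin_two]
  simp

/-- For `c ≠ b`, adjacency in the decoded graph is the value of `E c b`. [folklore] -/
theorem adj_iff_val_E {c b : Fin m} (hcb : c ≠ b) :
    (Gr x).Adj c b ↔ (hkDAG m).val x (edge c b) = true := by
  rw [val_E, SimpleGraph.fromRel_adj]
  exact ⟨fun h => h.2, fun h => ⟨hcb, h⟩⟩

/-- The value of a branch gate. [folklore] -/
theorem val_A (U : Finset (Fin m)) (a b c : Fin m) :
    (hkDAG m).val x (br U a b c) = true ↔
      ((if U.erase b = {a} then (hkDAG m).val x (edge c b) else (hkDAG m).val x (tab (U.erase b) a c)) = true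
        ∧ (hkDAG m).val x (edge c b) = true) := by
  rw [GateDAG.val_eq]
  show decide (∀ i : Fin 2, GateDAG.wire x ((hkDAG m).val x)
    (if (i : ℕ) = 0 then (if U.erase b = {a} then Sum.inr (edge c b) else Sum.inr (tab (U.erase b) a c))
      else Sum.inr (edge c b)) = true) = true ↔ _
  rw [decide_eq_true_iff, Fin.forall_fin_two]
  simp only [Fin.val_zero, ↓reduceIte, Fin.val_one, one_ne_zero, GateDAG.wire_inr]
  by_cases h : U.erase b = {a} <;> simp [h]

/-- The value of a table gate: some meaningful branch fires. [folklore] -/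
theorem val_P (U : Finset (Fin m)) (a b : Fin m) :
    (hkDAG m).val x (tab U a b) = true ↔ ∃ c, (a ∈ U ∧ b ∈ U ∧ a ≠ b ∧ c ∈ U.erase b) ∧ (hkDAG m).val x (br U a b c) = true := by
  rw [GateDAG.val_eq]
  show decide (∃ c : Fin m, GateDAG.wire x ((hkDAG m).val x)
    (if (a ∈ U ∧ b ∈ U ∧ a ≠ b ∧ c ∈ U.erase b) then Sum.inr (br U a b c) else Sum.inr ff) = true) = true ↔ _
  rw [decide_eq_true_iff]
  refine exists_congr fun c => ?_
  by_cases hv : (a ∈ U ∧ b ∈ U ∧ a ≠ b ∧ c ∈ U.erase b)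
  · rw [if_pos hv, GateDAG.wire_inr]
    exact ⟨fun h => ⟨hv, h⟩, fun h => h.2⟩
  · rw [if_neg hv, GateDAG.wire_inr, val_ff x]
    exact ⟨fun h => absurd h Bool.false_ne_true, fun h => absurd h.1 hv⟩

/-- The value of a closing test. [folklore] -/
theorem val_R (a b : Fin m) :
    (hkDAG m).val x (cl a b) = true ↔
      a ≠ b ∧ (hkDAG m).val x (tab Finset.univ a b) = true ∧ (hkDAG m).val x (edge b a) = true := by
  rw [GateDAG.val_eq]
  show decide (∀ i : Fin 2, GateDAG.wire x ((hkDAG m).val x)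
    (if a = b then Sum.inr ff else
      (if (i : ℕ) = 0 then Sum.inr (tab Finset.univ a b) else Sum.inr (edge b a))) = true) = true ↔ _
  rw [decide_eq_true_iff, Fin.forall_fin_two]
  simp only [Fin.val_zero, ↓reduceIte, Fin.val_one, one_ne_zero]
  by_cases hab : a = b <;> simp [hab, val_ff x]

/-- The value of `Q a`. [folklore] -/
theorem val_Q (a : Fin m) : (hkDAG m).val x (st a) = true ↔ ∃ b, (hkDAG m).val x (cl a b) = true := by
  rw [GateDAG.val_eq]
  show decide (∃ b : Fin m, GateDAG.wire x ((hkDAG m).val x) (Sum.inr (cl a b)) = true) = true ↔ _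
  rw [decide_eq_true_iff]
  simp

/-- The value of the output gate. [folklore] -/
theorem val_out : (hkDAG m).val x HKNode.out = true ↔ ∃ a, (hkDAG m).val x (st a) = true := by
  rw [GateDAG.val_eq]
  show decide (∃ a : Fin m, GateDAG.wire x ((hkDAG m).val x) (Sum.inr (st a)) = true) = true ↔ _
  rw [decide_eq_true_iff]
  simp

/-- If `a ∈ U ∖ b` and `U ∖ b` is not `{a}`, then `U ∖ b` has at least two elements. [folklore] -/
theorem two_le_card_erase {U : Finset (Fin m)} {a b : Fin m} (ha : a ∈ U.erase b)
    (hne : U.erase b ≠ {a}) : 2 ≤ (U.erase b).card := by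
  by_contra hlt
  have h1 : (U.erase b).card ≤ 1 := by omega
  exact hne (Finset.eq_singleton_iff_unique_mem.2 ⟨ha, fun v hv => Finset.card_le_one.1 h1 v hv a ha⟩)

/-- **The DAG computes the Held–Karp table**: for `|U| ≥ 2`, gate `P U a b` fires iff some
duplicate-free path of `Gr x` from `a` to `b` has vertex set exactly `U`. [folklore] -/
theorem val_P_iff : ∀ (n : ℕ) (U : Finset (Fin m)) (a b : Fin m), U.card = n → 2 ≤ n →
    ((hkDAG m).val x (tab U a b) = true ↔ HKSpec (Gr x).Adj U a b) := by
  intro n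
  induction n with
  | zero => intro U a b _ h; omega
  | succ n ih =>
    intro U a b hU hn
    rw [val_P]
    by_cases hab : a = b
    · subst hab
      constructor
      · rintro ⟨c, hv, -⟩
        exact absurd rfl hv.2.2.1
      · intro h
        exact absurd h (not_hkSpec_self (by omega))
    rw [hkSpec_step hab]
    by_cases hbase : U.erase b = {a}
    · -- `U = {a, b}`: the branch reads `E(a,b)` alone
      have haU : a ∈ U := Finset.mem_of_mem_erase (hbase ▸ Finset.mem_singleton_self a)
      constructor
      · rintro ⟨c, hv, hA⟩
        rw [val_A, if_pos hbase] at hA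
        have hc : c ∈ U.erase b := hv.2.2.2
        refine ⟨hv.2.1, c, hc, (adj_iff_val_E x (Finset.mem_erase.1 hc).1).2 hA.2, ?_⟩
        rw [hbase] at hc ⊢
        rw [Finset.mem_singleton] at hc
        exact (hkSpec_singleton_iff a c).2 hc
      · rintro ⟨hbU, c, hc, hR, -⟩
        refine ⟨c, ⟨haU, hbU, hab, hc⟩, ?_⟩
        rw [val_A, if_pos hbase]
        have := (adj_iff_val_E x (Finset.mem_erase.1 hc).1).1 hR
        exact ⟨this, this⟩
    · -- `|U ∖ b| ≥ 2`: induction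
      constructor
      · rintro ⟨c, hv, hA⟩
        rw [val_A, if_neg hbase] at hA
        have hc : c ∈ U.erase b := hv.2.2.2
        have hcard : (U.erase b).card = n := by
          rw [Finset.card_erase_of_mem hv.2.1, hU]; rfl
        have hn2 : 2 ≤ n :=
          hcard ▸ two_le_card_erase (Finset.mem_erase.2 ⟨hab, hv.1⟩) hbase
        refine ⟨hv.2.1, c, hc, (adj_iff_val_E x (Finset.mem_erase.1 hc).1).2 hA.2, ?_⟩
        exact (ih (U.erase b) a c hcard hn2).1 hA.1
      · rintro ⟨hbU, c, hc, hR, hspec⟩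
        have haU : a ∈ U := Finset.mem_of_mem_erase hspec.left_mem
        refine ⟨c, ⟨haU, hbU, hab, hc⟩, ?_⟩
        rw [val_A, if_neg hbase]
        have hcard : (U.erase b).card = n := by
          rw [Finset.card_erase_of_mem hbU, hU]; rfl
        have hn2 : 2 ≤ n := hcard ▸ two_le_card_erase hspec.left_mem hbase
        exact ⟨(ih (U.erase b) a c hcard hn2).2 hspec,
          (adj_iff_val_E x (Finset.mem_erase.1 hc).1).1 hR⟩

/-- **The Held–Karp DAG decides Hamiltonicity** (on `m ≥ 3` vertices). [folklore] -/
theorem evalOut_hkDAG (hm : 3 ≤ m) : (hkDAG m).evalOut x = true ↔ (Gr x).IsHamiltonian := by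
  have hcard : 3 ≤ Fintype.card (Fin m) := by simpa using hm
  rw [isHamiltonian_iff_hkSpec _ hcard]
  show GateDAG.wire x ((hkDAG m).val x) (Sum.inr HKNode.out) = true ↔ _
  rw [GateDAG.wire_inr, val_out]
  simp only [val_Q, val_R]
  constructor
  · rintro ⟨a, b, hab, hP, hE⟩
    refine ⟨a, b, hab, (adj_iff_val_E x (Ne.symm hab)).2 hE, ?_⟩
    exact (val_P_iff x m Finset.univ a b (by simp) (by omega)).1 hP
  · rintro ⟨a, b, hab, hadj, hspec⟩
    refine ⟨a, b, hab, ?_, (adj_iff_val_E x (Ne.symm hab)).1 hadj⟩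
    exact (val_P_iff x m Finset.univ a b (by simp) (by omega)).2 hspec

open scoped Classical in
/-- Hence the compiled program computes the route's `HAM_m`. [folklore] -/
theorem compile_hkDAG_eval (hm : 3 ≤ m) :
    (hkDAG m).compile.eval x = decide (Gr x).IsHamiltonian := by
  rw [GateDAG.compile_eval]
  rcases h : (hkDAG m).evalOut x with _ | _
  · symm
    rw [decide_eq_false_iff_not, ← evalOut_hkDAG x hm, h]
    exact Bool.false_ne_true
  · symm
    exact decide_eq_true ((evalOut_hkDAG x hm).1 h)

end Semantics

/-! ## §4 Symmetry: every vertex permutation is an automorphism -/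

section Symmetry

variable (ρ : Equiv.Perm (Fin m))

/-- The diagonal action on matrix entries, as a permutation. [folklore] -/
abbrev diag (ρ : Equiv.Perm (Fin m)) : Equiv.Perm (Fin m × Fin m) := Equiv.prodCongr ρ ρ

/-- The diagonal permutation as a function. [folklore] -/
theorem coe_diag : (⇑(diag ρ) : Fin m × Fin m → Fin m × Fin m) = fun q => (ρ q.1, ρ q.2) := rfl

/-- `ρ` commutes with erasing a vertex. [folklore] -/
theorem image_erase (U : Finset (Fin m)) (b : Fin m) :
    (U.image ρ).erase (ρ b) = (U.erase b).image ρ :=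
  (Finset.image_erase ρ.injective U b).symm

/-- `ρ U = {ρ a} ↔ U = {a}`. [folklore] -/
theorem image_eq_singleton_iff (U : Finset (Fin m)) (a : Fin m) :
    U.image ρ = {ρ a} ↔ U = {a} := by
  rw [← Finset.image_singleton ρ a]
  exact (Finset.image_injective ρ.injective).eq_iff

/-- Meaningfulness of a branch is invariant under `ρ`. [folklore] -/
theorem valid_act_iff (U : Finset (Fin m)) (a b c : Fin m) :
    (ρ a ∈ U.image ρ ∧ ρ b ∈ U.image ρ ∧ ρ a ≠ ρ b ∧ ρ c ∈ (U.image ρ).erase (ρ b)) ↔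
      (a ∈ U ∧ b ∈ U ∧ a ≠ b ∧ c ∈ U.erase b) := by
  simp only [ρ.injective.mem_finset_image, ρ.injective.ne_iff, image_erase]

/-- **`(U,a,b) ↦ (ρU, ρa, ρb)` is an automorphism of the Held–Karp DAG over the diagonal action of
`ρ`**, for EVERY permutation `ρ` of the vertices. [folklore] -/
theorem hkDAG_isAut : (hkDAG m).IsAut (diag ρ) (actEquiv ρ) := by
  refine ⟨rfl, fun l => by cases l <;> rfl, fun l => ?_⟩
  cases l with
  | tab U a b =>
    let f : Fin m → (Fin m × Fin m) ⊕ HKNode m := fun c =>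
      if (ρ a ∈ U.image ρ ∧ ρ b ∈ U.image ρ ∧ ρ a ≠ ρ b ∧ c ∈ (U.image ρ).erase (ρ b)) then
        Sum.inr (br (U.image ρ) (ρ a) (ρ b) c) else Sum.inr ff
    have hf : (Sum.map (diag ρ) (actEquiv ρ)) ∘ (HKNode.args (tab U a b)) = f ∘ ρ := by
      funext c
      show Sum.map (diag ρ) (actEquiv ρ)
          (if (a ∈ U ∧ b ∈ U ∧ a ≠ b ∧ c ∈ U.erase b) then Sum.inr (br U a b c) else Sum.inr ff) =
        (if (ρ a ∈ U.image ρ ∧ ρ b ∈ U.image ρ ∧ ρ a ≠ ρ b ∧ ρ c ∈ (U.image ρ).erase (ρ b)) then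
          Sum.inr (br (U.image ρ) (ρ a) (ρ b) (ρ c)) else Sum.inr ff)
      by_cases hv : (a ∈ U ∧ b ∈ U ∧ a ≠ b ∧ c ∈ U.erase b)
      · rw [if_pos hv, if_pos ((valid_act_iff ρ U a b c).2 hv)]
        rfl
      · rw [if_neg hv, if_neg (mt (valid_act_iff ρ U a b c).1 hv)]
        rfl
    show (List.ofFn f).Perm ((List.ofFn (HKNode.args (tab U a b))).map (Sum.map (diag ρ) (actEquiv ρ)))
    rw [List.map_ofFn, hf]
    exact (Equiv.Perm.ofFn_comp_perm ρ f).symm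
  | br U a b c =>
    show (List.ofFn (HKNode.args (br (U.image ρ) (ρ a) (ρ b) (ρ c)))).Perm
      ((List.ofFn (HKNode.args (br U a b c))).map (Sum.map (diag ρ) (actEquiv ρ)))
    rw [ofFn_args_A, ofFn_args_A]
    simp only [image_erase, image_eq_singleton_iff, List.map_cons, List.map_nil]
    by_cases h : U.erase b = {a}
    · simp only [h, ↓reduceIte, Sum.map_inr, actEquiv_apply, HKNode.act]
      exact List.Perm.refl _
    · simp only [h, ↓reduceIte, Sum.map_inr, actEquiv_apply, HKNode.act]
      exact List.Perm.refl _
  | edge c b =>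
    show (List.ofFn (HKNode.args (edge (ρ c) (ρ b)))).Perm
      ((List.ofFn (HKNode.args (edge c b))).map (Sum.map (diag ρ) (actEquiv ρ)))
    rw [ofFn_args_E, ofFn_args_E]
    exact List.Perm.refl _
  | cl a b =>
    show (List.ofFn (HKNode.args (cl (ρ a) (ρ b)))).Perm
      ((List.ofFn (HKNode.args (cl a b))).map (Sum.map (diag ρ) (actEquiv ρ)))
    rw [ofFn_args_R, ofFn_args_R]
    simp only [ρ.injective.eq_iff, List.map_cons, List.map_nil]
    by_cases h : a = b
    · simp only [h, ↓reduceIte, Sum.map_inr, actEquiv_apply, HKNode.act]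
      exact List.Perm.refl _
    · simp only [h, ↓reduceIte, Sum.map_inr, actEquiv_apply, HKNode.act, Finset.image_univ_equiv]
      exact List.Perm.refl _
  | st a =>
    let f : Fin m → (Fin m × Fin m) ⊕ HKNode m := fun b => Sum.inr (cl (ρ a) b)
    have hf : (Sum.map (diag ρ) (actEquiv ρ)) ∘ (HKNode.args (st a)) = f ∘ ρ := by
      funext b; rfl
    show (List.ofFn f).Perm ((List.ofFn (HKNode.args (st a))).map (Sum.map (diag ρ) (actEquiv ρ)))
    rw [List.map_ofFn, hf]
    exact (Equiv.Perm.ofFn_comp_perm ρ f).symm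
  | out =>
    let f : Fin m → (Fin m × Fin m) ⊕ HKNode m := fun a => Sum.inr (st a)
    have hf : (Sum.map (diag ρ) (actEquiv ρ)) ∘ (HKNode.args (HKNode.out : HKNode m)) = f ∘ ρ := by
      funext a; rfl
    show (List.ofFn f).Perm
      ((List.ofFn (HKNode.args (HKNode.out : HKNode m))).map (Sum.map (diag ρ) (actEquiv ρ)))
    rw [List.map_ofFn, hf]
    exact (Equiv.Perm.ofFn_comp_perm ρ f).symm
  | ff =>
    show (List.ofFn (HKNode.args (HKNode.ff : HKNode m))).Perm
      ((List.ofFn (HKNode.args (HKNode.ff : HKNode m))).map (Sum.map (diag ρ) (actEquiv ρ)))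
    rw [ofFn_args_ff]
    exact List.Perm.refl _

/-- The compiled Held–Karp program is symmetric under EVERY set of vertex permutations. [folklore] -/
theorem compile_hkDAG_isSymmetricUnder (Γ : Set (Equiv.Perm (Fin m))) :
    (hkDAG m).compile.IsSymmetricUnder Γ := by
  rw [GateDAG.isSymmetricUnder_compile_iff]
  rintro π ⟨ρ, -, rfl⟩
  exact ⟨actEquiv ρ, (coe_diag ρ) ▸ hkDAG_isAut ρ⟩

end Symmetry

/-! ## §5 Orbits under the budget group -/

section Orbits

variable (m)

/-- The free block: the last `g` vertices (those the budget group may move). [folklore] -/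
def freeBlock (g : ℕ) : Finset (Fin m) := Finset.univ.filter fun i => m ≤ (i : ℕ) + g

variable {m}

/-- Membership in the free block. [folklore] -/
theorem mem_freeBlock {g : ℕ} {i : Fin m} : i ∈ freeBlock m g ↔ m ≤ (i : ℕ) + g := by
  simp [freeBlock]

/-- The free block has at most `g` vertices. [folklore] -/
theorem card_freeBlock_le (g : ℕ) : (freeBlock m g).card ≤ g := by
  have h : (freeBlock m g).card ≤ (Finset.range g).card := by
    refine Finset.card_le_card_of_injOn (fun i => (i : ℕ) + g - m) (fun i hi => ?_) ?_
    · rw [Finset.mem_coe, mem_freeBlock] at hi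
      rw [Finset.mem_coe, Finset.mem_range]
      have := i.2
      show (i : ℕ) + g - m < g
      omega
    · intro i hi j hj hij
      rw [Finset.mem_coe, mem_freeBlock] at hi hj
      apply Fin.ext
      change (i : ℕ) + g - m = (j : ℕ) + g - m at hij
      omega
  simpa using h

variable {g : ℕ} {ρ : Equiv.Perm (Fin m)}

/-- Budget permutations fix the vertices outside the free block. [folklore] -/
theorem apply_of_not_mem_freeBlock (hρ : ρ ∈ pointStabiliserBudget m g) {i : Fin m}
    (hi : i ∉ freeBlock m g) : ρ i = i :=
  hρ i (by rw [mem_freeBlock] at hi; omega)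

/-- Budget permutations preserve the free block. [folklore] -/
theorem apply_mem_freeBlock (hρ : ρ ∈ pointStabiliserBudget m g) {i : Fin m}
    (hi : i ∈ freeBlock m g) : ρ i ∈ freeBlock m g := by
  by_contra h
  have h1 : ρ (ρ i) = ρ i := apply_of_not_mem_freeBlock hρ h
  have : ρ i = i := ρ.injective h1
  rw [this] at h
  exact h hi

/-- A budget permutation moves a vertex inside `insert a (freeBlock)`. [folklore] -/
theorem apply_mem_insert (hρ : ρ ∈ pointStabiliserBudget m g) (a : Fin m) :
    ρ a ∈ insert a (freeBlock m g) := by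
  by_cases ha : a ∈ freeBlock m g
  · exact Finset.mem_insert_of_mem (apply_mem_freeBlock hρ ha)
  · rw [apply_of_not_mem_freeBlock hρ ha]
    exact Finset.mem_insert_self a _

/-- A budget permutation moves a vertex set `U` to `(U ∖ F) ∪ S` for some `S ⊆ F`. [folklore] -/
theorem image_mem_shifts (hρ : ρ ∈ pointStabiliserBudget m g) (U : Finset (Fin m)) :
    U.image ρ ∈ (freeBlock m g).powerset.image fun S => (U \ freeBlock m g) ∪ S := by
  rw [Finset.mem_image]
  refine ⟨(U ∩ freeBlock m g).image ρ, ?_, ?_⟩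
  · rw [Finset.mem_powerset]
    intro j hj
    rw [Finset.mem_image] at hj
    obtain ⟨i, hi, rfl⟩ := hj
    exact apply_mem_freeBlock hρ (Finset.mem_inter.1 hi).2
  · ext j
    simp only [Finset.mem_union, Finset.mem_sdiff, Finset.mem_image, Finset.mem_inter]
    constructor
    · rintro (⟨hjU, hjF⟩ | ⟨i, ⟨hiU, hiF⟩, rfl⟩)
      · exact ⟨j, hjU, apply_of_not_mem_freeBlock hρ hjF⟩
      · exact ⟨i, hiU, rfl⟩
    · rintro ⟨i, hiU, rfl⟩
      by_cases hiF : i ∈ freeBlock m g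
      · exact Or.inr ⟨i, ⟨hiU, hiF⟩, rfl⟩
      · rw [apply_of_not_mem_freeBlock hρ hiF]
        exact Or.inl ⟨hiU, hiF⟩

variable (m g)

/-- The family of automorphisms used to trace orbits: `(diag ρ, act ρ)` for `ρ` in the budget. [folklore] -/
def autFamily : Set (Equiv.Perm (Fin m × Fin m) × (HKNode m ≃ HKNode m)) :=
  {a | ∃ ρ ∈ pointStabiliserBudget m g, a = (diag ρ, actEquiv ρ)}

variable {m g}

/-- Every member of the family is an automorphism. [folklore] -/
theorem autFamily_isAut : ∀ a ∈ autFamily m g, (hkDAG m).IsAut (⇑a.1) a.2 := by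
  rintro a ⟨ρ, -, rfl⟩
  exact hkDAG_isAut ρ

/-- The family covers every diagonal map of the budget group. [folklore] -/
theorem autFamily_covers : ∀ π ∈ GateDAG.diagMaps (pointStabiliserBudget m g),
    ∃ a ∈ autFamily m g, (⇑a.1 : Fin m × Fin m → Fin m × Fin m) = π := by
  rintro π ⟨ρ, hρ, rfl⟩
  exact ⟨(diag ρ, actEquiv ρ), ⟨ρ, hρ, rfl⟩, coe_diag ρ⟩

/-- Traced orbits are images under `act`. [folklore] -/
theorem traced_autFamily_subset (l : HKNode m) :
    GateDAG.traced (autFamily m g) l ⊆ {l' | ∃ ρ ∈ pointStabiliserBudget m g, act ρ l = l'} := by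
  rintro l' ⟨a, ⟨ρ, hρ, rfl⟩, rfl⟩
  exact ⟨ρ, hρ, rfl⟩

/-- A traced orbit contained in (the coercion of) a finset is bounded by its cardinality. [folklore] -/
theorem ncard_traced_le_of_subset {l : HKNode m} {T : Finset (HKNode m)}
    (h : ∀ ρ ∈ pointStabiliserBudget m g, act ρ l ∈ T) :
    (GateDAG.traced (autFamily m g) l).ncard ≤ T.card := by
  rw [← Set.ncard_coe_finset]
  refine Set.ncard_le_ncard ((traced_autFamily_subset l).trans ?_) (Finset.finite_toSet T)
  rintro l' ⟨ρ, hρ, rfl⟩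
  exact h ρ hρ

/-- Arithmetic of the bound. [folklore] -/
theorem shifts_card_le (U : Finset (Fin m)) :
    ((freeBlock m g).powerset.image fun S => (U \ freeBlock m g) ∪ S).card ≤ 2 ^ g :=
  Finset.card_image_le.trans (by
    rw [Finset.card_powerset]
    exact Nat.pow_le_pow_right (by norm_num) (card_freeBlock_le g))

/-- `|insert a F| ≤ g + 1`. [folklore] -/
theorem insert_card_le (a : Fin m) : (insert a (freeBlock m g)).card ≤ g + 1 :=
  (Finset.card_insert_le a _).trans (Nat.add_le_add_right (card_freeBlock_le g) 1)

/-- Elementary inequalities used in the orbit bound. [folklore] -/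
theorem bound_aux (g : ℕ) :
    (g + 1) * (g + 1) ≤ 2 ^ g * (g + 1) ^ 3 ∧ g + 1 ≤ 2 ^ g * (g + 1) ^ 3 ∧ 1 ≤ 2 ^ g * (g + 1) ^ 3 := by
  have h3 : (g + 1) ^ 3 ≤ 2 ^ g * (g + 1) ^ 3 := Nat.le_mul_of_pos_left _ Nat.one_le_two_pow
  have h2 : (g + 1) * (g + 1) ≤ (g + 1) ^ 3 := by
    rw [pow_succ, pow_two]
    exact Nat.le_mul_of_pos_right _ (Nat.succ_pos g)
  have h1 : g + 1 ≤ (g + 1) * (g + 1) := Nat.le_mul_of_pos_right _ (Nat.succ_pos g)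
  have h0 : 1 ≤ g + 1 := Nat.succ_pos g
  exact ⟨h2.trans h3, h1.trans (h2.trans h3), h0.trans (h1.trans (h2.trans h3))⟩

/-- **Every traced orbit of the Held–Karp DAG under `Bud(m,g)` has at most `2^g·(g+1)^3` gates.** [folklore] -/
theorem ncard_traced_le (l : HKNode m) :
    (GateDAG.traced (autFamily m g) l).ncard ≤ 2 ^ g * (g + 1) ^ 3 := by
  obtain ⟨b2, b1, b0⟩ := bound_aux g
  cases l with
  | tab U a b =>
    refine (ncard_traced_le_of_subset (T := (((freeBlock m g).powerset.image fun S =>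
        (U \ freeBlock m g) ∪ S) ×ˢ (insert a (freeBlock m g) ×ˢ insert b (freeBlock m g))).image
        fun t => tab t.1 t.2.1 t.2.2) fun ρ hρ => ?_).trans ?_
    · exact Finset.mem_image.2 ⟨(U.image ρ, ρ a, ρ b), Finset.mem_product.2
        ⟨image_mem_shifts hρ U, Finset.mem_product.2 ⟨apply_mem_insert hρ a, apply_mem_insert hρ b⟩⟩,
        rfl⟩
    · refine Finset.card_image_le.trans ?_
      rw [Finset.card_product, Finset.card_product]
      calc _ ≤ 2 ^ g * ((g + 1) * (g + 1)) := Nat.mul_le_mul (shifts_card_le U)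
              (Nat.mul_le_mul (insert_card_le a) (insert_card_le b))
        _ ≤ 2 ^ g * (g + 1) ^ 3 := Nat.mul_le_mul_left _ (by
              rw [pow_succ, pow_two]; exact Nat.le_mul_of_pos_right _ (Nat.succ_pos g))
  | br U a b c =>
    refine (ncard_traced_le_of_subset (T := (((freeBlock m g).powerset.image fun S =>
        (U \ freeBlock m g) ∪ S) ×ˢ (insert a (freeBlock m g) ×ˢ (insert b (freeBlock m g) ×ˢ
        insert c (freeBlock m g)))).image fun t => br t.1 t.2.1 t.2.2.1 t.2.2.2)
        fun ρ hρ => ?_).trans ?_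
    · exact Finset.mem_image.2 ⟨(U.image ρ, ρ a, ρ b, ρ c), Finset.mem_product.2
        ⟨image_mem_shifts hρ U, Finset.mem_product.2 ⟨apply_mem_insert hρ a, Finset.mem_product.2
          ⟨apply_mem_insert hρ b, apply_mem_insert hρ c⟩⟩⟩, rfl⟩
    · refine Finset.card_image_le.trans ?_
      rw [Finset.card_product, Finset.card_product, Finset.card_product]
      calc _ ≤ 2 ^ g * ((g + 1) * ((g + 1) * (g + 1))) := Nat.mul_le_mul (shifts_card_le U)
              (Nat.mul_le_mul (insert_card_le a)
                (Nat.mul_le_mul (insert_card_le b) (insert_card_le c)))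
        _ = 2 ^ g * (g + 1) ^ 3 := by ring
  | edge c b =>
    refine (ncard_traced_le_of_subset
      (T := (insert c (freeBlock m g) ×ˢ insert b (freeBlock m g)).image fun t => edge t.1 t.2)
      fun ρ hρ => ?_).trans ?_
    · exact Finset.mem_image.2 ⟨(ρ c, ρ b),
        Finset.mem_product.2 ⟨apply_mem_insert hρ c, apply_mem_insert hρ b⟩, rfl⟩
    · refine Finset.card_image_le.trans ?_
      rw [Finset.card_product]
      exact (Nat.mul_le_mul (insert_card_le c) (insert_card_le b)).trans b2
  | cl a b =>
    refine (ncard_traced_le_of_subset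
      (T := (insert a (freeBlock m g) ×ˢ insert b (freeBlock m g)).image fun t => cl t.1 t.2)
      fun ρ hρ => ?_).trans ?_
    · exact Finset.mem_image.2 ⟨(ρ a, ρ b),
        Finset.mem_product.2 ⟨apply_mem_insert hρ a, apply_mem_insert hρ b⟩, rfl⟩
    · refine Finset.card_image_le.trans ?_
      rw [Finset.card_product]
      exact (Nat.mul_le_mul (insert_card_le a) (insert_card_le b)).trans b2
  | st a =>
    refine (ncard_traced_le_of_subset (T := (insert a (freeBlock m g)).image fun t => st t)
      fun ρ hρ => ?_).trans ?_
    · exact Finset.mem_image.2 ⟨ρ a, apply_mem_insert hρ a, rfl⟩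
    · exact Finset.card_image_le.trans ((insert_card_le a).trans b1)
  | out =>
    refine (ncard_traced_le_of_subset (T := {HKNode.out}) fun ρ hρ => by simp [HKNode.act]).trans ?_
    rw [Finset.card_singleton]
    exact b0
  | ff =>
    refine (ncard_traced_le_of_subset (T := {HKNode.ff}) fun ρ hρ => by simp [HKNode.act]).trans ?_
    rw [Finset.card_singleton]
    exact b0

end Orbits

/-! ## §6 The theorems -/

/-- The size of the (unreduced) Held–Karp program: at most `7·2^m·m³` gates (`m ≥ 1`). [folklore] -/
theorem card_hkNode_le (hm : 1 ≤ m) : Fintype.card (HKNode m) ≤ 7 * (2 ^ m * m ^ 3) := by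
  let S := (Finset (Fin m) × Fin m × Fin m) ⊕ (Finset (Fin m) × Fin m × Fin m × Fin m) ⊕
    (Fin m × Fin m) ⊕ (Fin m × Fin m) ⊕ Fin m ⊕ Unit ⊕ Unit
  let ψ : S → HKNode m := fun s =>
    match s with
    | Sum.inl ⟨U, a, b⟩ => HKNode.tab U a b
    | Sum.inr (Sum.inl ⟨U, a, b, c⟩) => HKNode.br U a b c
    | Sum.inr (Sum.inr (Sum.inl ⟨c, b⟩)) => HKNode.edge c b
    | Sum.inr (Sum.inr (Sum.inr (Sum.inl ⟨a, b⟩))) => HKNode.cl a b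
    | Sum.inr (Sum.inr (Sum.inr (Sum.inr (Sum.inl a)))) => HKNode.st a
    | Sum.inr (Sum.inr (Sum.inr (Sum.inr (Sum.inr (Sum.inl _))))) => HKNode.out
    | Sum.inr (Sum.inr (Sum.inr (Sum.inr (Sum.inr (Sum.inr _))))) => HKNode.ff
  have hψ : Function.Surjective ψ := by
    intro l
    cases l with
    | tab U a b => exact ⟨Sum.inl ⟨U, a, b⟩, rfl⟩
    | br U a b c => exact ⟨Sum.inr (Sum.inl ⟨U, a, b, c⟩), rfl⟩
    | edge c b => exact ⟨Sum.inr (Sum.inr (Sum.inl ⟨c, b⟩)), rfl⟩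
    | cl a b => exact ⟨Sum.inr (Sum.inr (Sum.inr (Sum.inl ⟨a, b⟩))), rfl⟩
    | st a => exact ⟨Sum.inr (Sum.inr (Sum.inr (Sum.inr (Sum.inl a)))), rfl⟩
    | out => exact ⟨Sum.inr (Sum.inr (Sum.inr (Sum.inr (Sum.inr (Sum.inl ()))))), rfl⟩
    | ff => exact ⟨Sum.inr (Sum.inr (Sum.inr (Sum.inr (Sum.inr (Sum.inr ()))))), rfl⟩
  have hcard := Fintype.card_le_of_surjective ψ hψ
  have hS : Fintype.card S = 2 ^ m * m ^ 2 + 2 ^ m * m ^ 3 + m ^ 2 + m ^ 2 + m + 1 + 1 := by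
    simp only [S, Fintype.card_sum, Fintype.card_prod, Fintype.card_finset, Fintype.card_fin,
      Fintype.card_unit]
    ring
  rw [hS] at hcard
  have T1 : 2 ^ m * m ^ 2 ≤ 2 ^ m * m ^ 3 :=
    Nat.mul_le_mul_left _ (Nat.pow_le_pow_right hm (by norm_num))
  have T2 : m ^ 2 ≤ 2 ^ m * m ^ 3 :=
    (Nat.pow_le_pow_right hm (by norm_num : 2 ≤ 3)).trans (Nat.le_mul_of_pos_left _ Nat.one_le_two_pow)
  have T3 : m ≤ 2 ^ m * m ^ 3 := by
    calc m = m ^ 1 := (pow_one m).symm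
      _ ≤ m ^ 3 := Nat.pow_le_pow_right hm (by norm_num)
      _ ≤ 2 ^ m * m ^ 3 := Nat.le_mul_of_pos_left _ Nat.one_le_two_pow
  have T4 : 1 ≤ 2 ^ m * m ^ 3 := Nat.mul_pos Nat.one_le_two_pow (Nat.pow_pos hm)
  omega

open scoped Classical in
/-- **Held–Karp as a symmetric circuit (plain form).** For `m ≥ 3` and EVERY set `Γ` of vertex
permutations, the Held–Karp program is a `Γ`-symmetric `tcBasis`-circuit with at most `7·2^m·m³`
gates computing `x ↦ [Gr x is Hamiltonian]`; in particular `HasSymCircuit tcBasis Γ (7·2^m·m³) HAM_m`. [folklore] -/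
theorem hasSymCircuit_ham (hm : 3 ≤ m) (Γ : Set (Equiv.Perm (Fin m))) :
    HasSymCircuit tcBasis Γ (7 * (2 ^ m * m ^ 3))
      (fun x : Fin m × Fin m → Bool =>
        decide (SimpleGraph.fromRel fun u v => x (u, v) = true).IsHamiltonian) := by
  refine ⟨(hkDAG m).compile, (hkDAG m).compile_isOver hkDAG_fn_mem_tcBasis, ?_,
    compile_hkDAG_isSymmetricUnder Γ, fun x => compile_hkDAG_eval x hm⟩
  show (hkDAG m).compile.gates.length ≤ _
  rw [GateDAG.compile_gates_length]
  exact card_hkNode_le (by omega)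

open scoped Classical in
/-- **BN-W2, kernel-checked: an exact, rigid, `Bud(m,g)`-symmetric Held–Karp circuit for
Hamiltonicity with orbits of size at most `max (2^g·(g+1)^3) m²`**, for every `m ≥ 3` and every
budget `g`. (The circuit is the reduced form of the Held–Karp program; rigidity makes the orbit of a
gate the set of its images under the chosen automorphisms `act ρ`, `ρ ∈ Bud(m,g)`; the `m²` accounts
for the `∧₁`-chains on input wires introduced by the reduction.) [folklore] -/
theorem exists_symmetric_circuit (hm : 3 ≤ m) (g : ℕ) :
    ∃ C : Circuit (Fin m × Fin m), C.IsOver tcBasis ∧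
      C.IsSymmetricUnder (pointStabiliserBudget m g) ∧ C.IsRigid ∧
      C.Computes (fun x : Fin m × Fin m → Bool =>
        decide (SimpleGraph.fromRel fun u v => x (u, v) = true).IsHamiltonian) ∧
      C.orbitSize (pointStabiliserBudget m g) ≤ max (2 ^ g * (g + 1) ^ 3) (m ^ 2) := by
  let D := hkDAG m
  refine ⟨D.reduce.compile, ?_, ?_, ?_, ?_, ?_⟩
  · exact D.reduce.compile_isOver (D.reduce_fn_mem hkDAG_fn_mem_tcBasis and_one_mem_tcBasis)
  · rw [GateDAG.isSymmetricUnder_compile_iff]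
    intro π hπ
    obtain ⟨a, ha, rfl⟩ := autFamily_covers π hπ
    exact ⟨_, (autFamily_isAut a ha).reduce⟩
  · exact D.reduce.compile_isRigid D.isRigidDAG_reduce
  · intro x
    rw [GateDAG.compile_eval, GateDAG.evalOut_reduce _ hkDAG_fn_isSymmetric, ← GateDAG.compile_eval]
    exact compile_hkDAG_eval x hm
  · refine D.reduce.orbitSize_compile_le _ fun l => ?_
    refine (GateDAG.ncard_orbit_reduce_le (autFamily m g) autFamily_isAut autFamily_covers
      ncard_traced_le l).trans ?_
    rw [Fintype.card_prod, Fintype.card_fin, sq]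

open scoped Classical in
/-- **In the window the orbits are polynomial.** At the route's budget `g = ⌊log₂ m⌋` the exact
Held–Karp circuit has orbit size at most `m·(⌊log₂ m⌋+1)³ ⊔ m²` although (`WindowHam`, if true) no
polynomial-SIZE window-symmetric circuit computes `HAM_m`: orbit bounds alone cannot prove the crux. [folklore] -/
theorem exists_symmetric_circuit_log (hm : 3 ≤ m) :
    ∃ C : Circuit (Fin m × Fin m), C.IsOver tcBasis ∧
      C.IsSymmetricUnder (pointStabiliserBudget m (Nat.log 2 m)) ∧ C.IsRigid ∧
      C.Computes (fun x : Fin m × Fin m → Bool =>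
        decide (SimpleGraph.fromRel fun u v => x (u, v) = true).IsHamiltonian) ∧
      C.orbitSize (pointStabiliserBudget m (Nat.log 2 m)) ≤
        max (m * (Nat.log 2 m + 1) ^ 3) (m ^ 2) := by
  obtain ⟨C, hB, hS, hR, hC, hO⟩ := exists_symmetric_circuit hm (Nat.log 2 m)
  refine ⟨C, hB, hS, hR, hC, hO.trans (max_le_max ?_ le_rfl)⟩
  exact Nat.mul_le_mul_right _ (Nat.pow_log_le_self 2 (by omega))

end Literature.Computability.Complexity.HeldKarp
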